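import Literature.RingTheory.CompleteIntersection.NumericalCriterion
import Literature.RingTheory.CompleteIntersection.CriterionOne
import HarnessLib

/-!
# Route `PhantomRMYoshida`, crux `ResiduallyYoshidaLifting` (stmt-Langlands-13639), line
# `endoscopic-crossing-euler`: Stub 1, the Wiles–Lenstra numerical criterion over a complete DVR

The registered stub `stub_numericalCriterion` of the checked skeleton of the line
`endoscopic-crossing-euler` (namespace
`Summit.Langlands.Langlands.Cruxes.ResiduallyYoshidaLifting.EndoscopicCrossingEuler`), statement
verbatim: for a complete discrete valuation ring `O` with ARBITRARY residue field, a complete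
Noetherian local `O`-algebra `R`, a local `O`-algebra `T` finite and free over `O`, a surjection
`φ : R ↠ T` of `O`-algebras and an augmentation `π : T → O` with congruence ideal
`η_T = π(Ann_T ker π) ≠ 0`: if `length_O(I_R/I_R²) ≤ length_O(O/η_T)` (`I_R = ker(π ∘ φ)`), then
`φ` is bijective.

This is de Smit–Rubin–Schoof 1997, Criterion I (Wiles 1995 Appendix for `T` Gorenstein, Lenstra in
general; Darmon–Diamond–Taylor Thm. 5.3), direction "equality ⇒ isomorphism", which is in the tree,
proved unconditionally and without the completeness / locality-of-`T` hypotheses, as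
`Literature.RingTheory.CompleteIntersection.bijective_of_length_cotangentModule_le`
(`Literature/RingTheory/CompleteIntersection/CriterionOne.lean`). The stub is its specialisation to
universe `0` together with the (unused) extra hypotheses of the registration; equivalently the
`Function.Bijective φ` clause of the forward half of the tree's named fact
`Literature.RingTheory.CompleteIntersection.numericalCriterion_eq_iff.{0,0,0}` combined with the
proved inequality `numericalCriterion_le_holds` (cf. `bijective_of_numericalCriterion`).

## References

* B. de Smit, K. Rubin, R. Schoof, *Criteria for complete intersections*, in: Modular Forms and
  Fermat's Last Theorem, Springer 1997, 343–356: Criterion I (p. 344), §3 (pp. 350–353).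
  [DeSmitRubinSchoof1997]
* H. Darmon, F. Diamond, R. Taylor, *Fermat's Last Theorem*, Current Developments in Math. 1995,
  Thm. 5.3. [DarmonDiamondTaylor1995]
-/

open Literature.RingTheory.CompleteIntersection

namespace Summit.Langlands.Langlands.Cruxes.ResiduallyYoshidaLifting.EndoscopicCrossingEuler

set_option linter.dupNamespace false in
set_option linter.overlappingInstances false in
/-- **Stub 1 (numerical criterion, direction used).**  `O` a complete discrete valuation ring (NO
hypothesis on its residue field), `R` a complete Noetherian local `O`-algebra, `T` a local
`O`-algebra finite free over `O`, `φ : R ↠ T`, `π : T → O` an augmentation with congruence ideal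
`η_T ≠ 0`; if `length_O (I_R/I_R²) ≤ length_O (O/η_T)` then `φ` is an isomorphism.
de Smit–Rubin–Schoof 1997, Criterion I (Wiles–Lenstra), "`≤` ⇒ `φ` bijective", a specialisation
of the tree's `bijective_of_length_cotangentModule_le` (the completeness of `O` and `R` and the
locality of `T` are not used).
[cite: DeSmitRubinSchoof1997, Criterion I p. 344 and §3 pp. 352–353] -/
theorem stub_numericalCriterion :
    ∀ (O : Type) [CommRing O] [IsDomain O] [IsDiscreteValuationRing O]
      [IsAdicComplete (IsLocalRing.maximalIdeal O) O]
      (R : Type) [CommRing R] [IsLocalRing R] [IsNoetherianRing R]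
      [IsAdicComplete (IsLocalRing.maximalIdeal R) R] [Algebra O R]
      (T : Type) [CommRing T] [IsLocalRing T] [Algebra O T] [Module.Finite O T] [Module.Free O T]
      (φ : R →ₐ[O] T) (π : T →ₐ[O] O),
      Function.Surjective φ → congruenceIdeal π ≠ ⊥ →
        Module.length O (CotangentModule (π.comp φ)) ≤ Module.length O (CongruenceModule π) →
          Function.Bijective φ := by
  intro O _ _ _ _ R _ _ _ _ _ T _ _ _ _ _ φ π hφ hη hle
  exact bijective_of_length_cotangentModule_le φ π hφ hη hle

end Summit.Langlands.Langlands.Cruxes.ResiduallyYoshidaLifting.EndoscopicCrossingEuler
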